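import Summits.ABC.StewartYu.PadicG3TwoThirdStep
import Summits.ABC.StewartYu.PadicG3TwoMainChain
import HarnessLib

/-!
# Cell abc-stewartyu, Gen-3 frame at `p = 2` (crux `Y07Two`, stmt-ABC-19659), record interface: LOG FORMS of the
# frame's numeric hypotheses (the `hfinal` branches of `KFinalTwo` / `ThirdFinalTwo` from linear inequalities
# between logarithms; the logarithm of the Liouville constant `KTwo` and of the monomial denominators)

`Summits/ABC/StewartYu/PadicG3TwoLogForm.lean` — cell `abc-stewartyu` (HOME `run/shared/lean/pub/abc-stewartyu/`),
route `PadicPrimesKummerThird`, seat p5 (g3); service lemmas for the record seat (p1 / lp-1), twin of M2's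
`PadicTwoThirdLog.thirdFinal3_of_log_ineq` / `kFinal_of_log_ineq` pattern.  Theorems only, real arithmetic.

* `branch_comparison_lt_of_log` — `Bw·Λ·2ᵗ·2ᶜ < 1/K` from `Λ ≤ A·2^{−U}` and
  `log Bw + log A + log K + (t + c)·log 2 < U·log 2` (the `U`-branch: the zeros are only approximate);
* `branch_gain_lt_of_log` — `Bw/ρ^g < 1/K` from `log Bw + log K < g·log ρ` (the Schwarz-gain branch);
* `hfinal_of_log` — both ⇒ `max (…) (…) < 1/K`, literally the shape of `KFinalTwo.hfinal` / `ThirdFinalTwo.hfinal`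
  (with `ρ = 4·2^m`, and for the third step `1/K` replaced by the Liouville threshold, see `inv_thr_eq`);
* `log_KTwo_le` — `log KTwo ≤ log cardB + log P + log M₀ + |t|·log Xb + 2·log monDen`;
* `log_monDen_boxExp_le` — `log monDen(all, boxExp D_box D_θ x) ≤ 2|x|·(∑ⱼ Dⱼ·h(αⱼ) + D_θ·h(θ))`
  (`MonomialDen.log_monDen_le`): the far-height line of the ledgers.

WHAT THIS IS NOT: no numbers; no crux moves.

References: K. Yu, Acta Math. 211 (2013), (5.28)–(5.31), (5.40); Yu. V. Nesterenko, LNM 1819 (2003), §4.2 (4.24)–(4.35).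
-/

noncomputable section

open Finset Real
open Literature.NumberTheory.Transcendental
open Literature.NumberTheory.Transcendental.CW77.Setup (Tau tauNorm)

namespace Summit.ABC.StewartYu

namespace TwoSetup

/-! ### The two branches of the k-step / third-step inequality from logarithms -/

/-- **The comparison (`U`-) branch from logs**: `Λ ≤ A·2^{−U}`, `log Bw + log A + log K + (t+c)·log 2 < U·log 2`
⇒ `Bw·Λ·2ᵗ·2ᶜ < 1/K`. [cite: Yu2013, (5.28); shape only] -/
theorem branch_comparison_lt_of_log {Bw Λ A K : ℝ} {t c U : ℕ} (hBw : 0 < Bw) (hA : 0 < A) (hK : 0 < K)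
    (hΛ : Λ ≤ A * (2 : ℝ) ^ (-(U : ℤ)))
    (hlog : Real.log Bw + Real.log A + Real.log K + ((t : ℝ) + c) * Real.log 2 < U * Real.log 2) :
    Bw * Λ * (2 : ℝ) ^ t * (2 : ℝ) ^ c < 1 / K := by
  have h2 : (0 : ℝ) < 2 := by norm_num
  -- it suffices to bound with `Λ` replaced by `A·2^{−U}`
  have hstep : Bw * Λ * (2 : ℝ) ^ t * (2 : ℝ) ^ c ≤ Bw * (A * (2 : ℝ) ^ (-(U : ℤ))) * (2 : ℝ) ^ t * (2 : ℝ) ^ c := by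
    gcongr
  refine lt_of_le_of_lt hstep ?_
  rw [lt_div_iff₀ hK]
  -- take logarithms: the product is `exp(log Bw + log A − U log 2 + (t+c) log 2 + log K)`
  have hpos : 0 < Bw * (A * (2 : ℝ) ^ (-(U : ℤ))) * (2 : ℝ) ^ t * (2 : ℝ) ^ c * K := by positivity
  rw [← Real.log_lt_log_iff hpos one_pos, Real.log_one]
  rw [Real.log_mul (by positivity) hK.ne', Real.log_mul (by positivity) (by positivity),
    Real.log_mul (by positivity) (by positivity), Real.log_mul hBw.ne' (by positivity),
    Real.log_mul hA.ne' (by positivity), Real.log_zpow, Real.log_pow, Real.log_pow]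
  push_cast
  linarith

/-- **The Schwarz-gain branch from logs**: `log Bw + log K < g·log ρ` ⇒ `Bw/ρ^g < 1/K`.
[cite: Yu2013, (5.29)–(5.31); shape only] -/
theorem branch_gain_lt_of_log {Bw K ρ : ℝ} {g : ℕ} (hBw : 0 < Bw) (hK : 0 < K) (hρ : 0 < ρ)
    (hlog : Real.log Bw + Real.log K < g * Real.log ρ) : Bw / ρ ^ g < 1 / K := by
  have hρg : 0 < ρ ^ g := pow_pos hρ g
  rw [div_lt_div_iff₀ hρg hK, one_mul]
  have hpos : 0 < Bw * K := mul_pos hBw hK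
  rw [← Real.log_lt_log_iff hpos hρg, Real.log_mul hBw.ne' hK.ne', Real.log_pow]
  exact hlog

/-- **The `hfinal` shape from logs**: both branches ⇒ `max (Bw·Λ·2ᵗ·2ᶜ) (Bw/ρ^g) < 1/K`.
[cite: Yu2013, Lemma 5.2 (5.28)–(5.31); shape only] -/
theorem hfinal_of_log {Bw Λ A K ρ : ℝ} {t c U g : ℕ} (hBw : 0 < Bw) (hA : 0 < A) (hK : 0 < K) (hρ : 0 < ρ)
    (hΛ : Λ ≤ A * (2 : ℝ) ^ (-(U : ℤ)))
    (hU : Real.log Bw + Real.log A + Real.log K + ((t : ℝ) + c) * Real.log 2 < U * Real.log 2)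
    (hg : Real.log Bw + Real.log K < g * Real.log ρ) :
    max (Bw * Λ * (2 : ℝ) ^ t * (2 : ℝ) ^ c) (Bw / ρ ^ g) < 1 / K :=
  max_lt (branch_comparison_lt_of_log hBw hA hK hΛ hU) (branch_gain_lt_of_log hBw hK hρ hg)

/-- The third step's threshold as an inverse: `1/(6DM·P⁵)^{e} = 1/K` with `K = (6DM·P⁵)^{e}` — so
`hfinal_of_log` applies with `log K = e·(log 6 + log D + log M + 5 log P)`. [folklore] -/
theorem log_thr_eq {D M Ph : ℝ} (hD : 0 < D) (hM : 0 < M) (hP : 0 < Ph) (e : ℕ) :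
    Real.log ((6 * D * M * Ph ^ 5) ^ e) = e * (Real.log 6 + Real.log D + Real.log M + 5 * Real.log Ph) := by
  rw [Real.log_pow, Real.log_mul (by positivity) (by positivity), Real.log_mul (by positivity) hM.ne',
    Real.log_mul (by norm_num) hD.ne', Real.log_pow]
  push_cast
  ring

/-! ### The logarithm of the Liouville constant and of the monomial denominators -/

variable {S : TwoSetup} (σ : S.G3TwoSched)

/-- **`log KTwo ≤ log cardB + log P + log M₀ + |t|·log Xb + 2·log monDen`** (equality, all factors positive).
[cite: Yu2013, (5.35)–(5.40); shape only] -/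
theorem log_KTwo_eq (I : ℕ) (x : ℤ) (τ : Tau S.d) (hc : 0 < σ.cardB I) (hP : 0 < σ.P) (hM : 0 < σ.M₀ I x τ)
    (hXb : 0 < σ.Xb I) :
    Real.log (KTwo σ I x τ) = Real.log (σ.cardB I) + Real.log (σ.P : ℝ) + Real.log (σ.M₀ I x τ : ℝ) +
      (∑ j, τ.2 j : ℕ) * Real.log (σ.Xb I : ℝ) +
      2 * Real.log (MonomialDen.monDen S.toQ.all (S.boxExp (σ.Dbox I) (σ.Dθ I) x) : ℝ) := by
  unfold KTwo
  have hmon : (0 : ℝ) < (MonomialDen.monDen S.toQ.all (S.boxExp (σ.Dbox I) (σ.Dθ I) x) : ℝ) := by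
    exact_mod_cast MonomialDen.one_le_monDen _ S.toQ.all_ne _
  have hc' : (0 : ℝ) < (σ.cardB I : ℝ) := by exact_mod_cast hc
  have hP' : (0 : ℝ) < (σ.P : ℝ) := by exact_mod_cast hP
  have hM' : (0 : ℝ) < (σ.M₀ I x τ : ℝ) := by exact_mod_cast hM
  have hXb' : (0 : ℝ) < (σ.Xb I : ℝ) := by exact_mod_cast hXb
  rw [Real.log_mul (by positivity) (by positivity), Real.log_mul hc'.ne' hP'.ne',
    Real.log_mul (by positivity) (by positivity), Real.log_mul hM'.ne' (by positivity), Real.log_pow,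
    Real.log_pow]
  push_cast
  ring

/-- **The far-height line**: `log monDen(all, boxExp D_box D_θ x) ≤ 2|x|·(∑ⱼ D_boxⱼ·h(αⱼ) + D_θ·h(θ))`.
[cite: Nesterenko2003, §4.2 (4.26); shape only] -/
theorem log_monDen_boxExp_le (Dbox : Fin S.d → ℕ) (Dθ : ℕ) (x : ℤ) :
    Real.log (MonomialDen.monDen S.toQ.all (S.boxExp Dbox Dθ x) : ℝ) ≤
      2 * |(x : ℝ)| * (∑ j, (Dbox j : ℝ) * Height.logHeight₁ (S.α j) + Dθ * Height.logHeight₁ S.θ) := by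
  have h := MonomialDen.log_monDen_le S.toQ.all S.toQ.all_ne (S.boxExp Dbox Dθ x)
  refine h.trans (le_of_eq ?_)
  unfold boxExp SetupQ.all
  rw [Fin.sum_univ_castSucc]
  simp only [Fin.snoc_castSucc, Fin.snoc_last]
  have hx : ((x.natAbs : ℕ) : ℝ) = |(x : ℝ)| := by
    rw [Nat.cast_natAbs, Int.cast_abs]
  push_cast
  rw [hx]
  have e1 : ∑ j : Fin S.d, (Dbox j : ℝ) * |(x : ℝ)| * Height.logHeight₁ (S.α j) =
      |(x : ℝ)| * ∑ j : Fin S.d, (Dbox j : ℝ) * Height.logHeight₁ (S.α j) := by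
    rw [Finset.mul_sum]
    exact Finset.sum_congr rfl fun j _ => by ring
  rw [e1]
  ring

end TwoSetup

end Summit.ABC.StewartYu

end
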